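import Summits.NavierStokesRegularity.NavierStokesRegularity.Theorems.LevelSetModerationHighSpeedPressureWorkModeratedSlice
import Summits.NavierStokesRegularity.NavierStokesRegularity.Theorems.LevelSetModerationLevelSetEnergyInequalityTruncation

/-!
# Route LevelSetModeration — `HighSpeedPressureWork`: the level-set integration by parts

Support file for item stmt-NavierStokesRegularity-18149; proves the registered stub `stub_levelSetIBP`
of line `Sketch` (and the hypothesis `LevelSetIBP` of the birth-line transfer
`levelSetModeration_highSpeedPressureWork_of_headDecorrelation`): for a `C¹` divergence-free field `v`
on `ℝ³` with bounded super-level set `A = {c < |v|}` (`c > 0`) and `q ∈ C¹(ℝ³)`,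

  `-∫ (1 - c/|v|)₊ Dq(x)(v x) dx = ∫ 1_A (c/|v|²) (D|v|(x)(v x)) q(x) dx`.

Proof (Vasseur's truncation with the kink regularised as in the landed `ModerationIdentity`):
for a `C¹` profile `G` vanishing with its derivative `h` on `(-∞, c]`, the moderator
`θ = G(|v|) q` is `C¹` with compact support, so `∫ Dθ(v) = 0` (`div v = 0`,
`levelSetModeration_integral_fderiv_apply_eq_zero`), i.e. `∫ G(|v|) Dq(v) = -∫ q h(|v|) D|v|(v)`;
with the cut-offs `ρₙ(σ) = min 1 (max 0 (n(σ-c)))` and `hₙ(τ) = ρₙ(τ) c / max(τ,c/2)²`,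
`Gₙ(σ) = ∫_c^σ hₙ → (1 - c/σ)₊` and `hₙ(σ) → 1_{σ>c} c/σ²` boundedly, and dominated convergence on
both sides gives the identity.
-/

noncomputable section

-- single-conjunct summit: `Summit.<Summit>.<Problem>` repeats the name by the D-0017 layout
set_option linter.dupNamespace false

namespace Summit.NavierStokesRegularity.NavierStokesRegularity.Theorems

open MeasureTheory Set Filter Topology intervalIntegral
open scoped RealInnerProductSpace
open Literature.Analysis.FluidPDE

section IBP

variable {v : EuclideanSpace ℝ (Fin 3) → EuclideanSpace ℝ (Fin 3)} {c : ℝ}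

/-- **Regularised level-set integration by parts.** For `v ∈ C¹` divergence free with bounded
`{c < |v|}` (`c > 0`), `q ∈ C¹`, and a `C¹` profile `G` with continuous derivative `h`, both
vanishing on `(-∞, c]`: `∫ G(|v x|) Dq(x)(v x) dx = -∫ q(x) h(|v x|) D|v|(x)(v x) dx`
(the moderator `G(|v|) q` is `C¹` with compact support and `∫ D(G(|v|) q)(v) = 0`). [folklore] -/
theorem levelSetModeration_integral_comp_norm_mul_fderiv_apply (hc : 0 < c) (hv : ContDiff ℝ 1 v)
    (hdiv : VectorCalculus.IsDivFree v) (hbdd : Bornology.IsBounded {x | c < ‖v x‖})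
    {q : EuclideanSpace ℝ (Fin 3) → ℝ} (hq : ContDiff ℝ 1 q) {G h : ℝ → ℝ}
    (hG : ∀ σ, HasDerivAt G (h σ) σ) (hh : Continuous h) (hG0 : ∀ σ ≤ c, G σ = 0)
    (hh0 : ∀ σ ≤ c, h σ = 0) :
    ∫ x, G ‖v x‖ * fderiv ℝ q x (v x) =
      -∫ x, q x * (h ‖v x‖ * fderiv ℝ (fun y => ‖v y‖) x (v x)) := by
  set A : Set (EuclideanSpace ℝ (Fin 3)) := {x | c < ‖v x‖} with hA
  have hvc : Continuous v := hv.continuous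
  have hqc : Continuous q := hq.continuous
  have hDq : Continuous (fderiv ℝ q) := hq.continuous_fderiv one_ne_zero
  have hGc : Continuous G := continuous_iff_continuousAt.2 fun σ => (hG σ).continuousAt
  have hGC1 : ContDiff ℝ 1 G := by
    rw [contDiff_one_iff_deriv]
    refine ⟨fun σ => (hG σ).differentiableAt, ?_⟩
    rw [show deriv G = h from funext fun σ => (hG σ).deriv]
    exact hh
  have hs_at : ∀ x, v x ≠ 0 → ContDiffAt ℝ 1 (fun y => ‖v y‖) x := fun x hx =>
    hv.contDiffAt.norm ℝ hx
  -- points with `‖v‖ < c` form an open set on which `G(|v|)` and `h(|v|)` vanish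
  have hU : IsOpen {y : EuclideanSpace ℝ (Fin 3) | ‖v y‖ < c} := isOpen_lt hvc.norm continuous_const
  -- `x ↦ G(|v x|)` is `C¹`
  set Gn : EuclideanSpace ℝ (Fin 3) → ℝ := fun x => G ‖v x‖ with hGn
  have hGnC1 : ContDiff ℝ 1 Gn := by
    rw [contDiff_iff_contDiffAt]
    intro x
    by_cases hx : v x = 0
    · have hxU : x ∈ {y : EuclideanSpace ℝ (Fin 3) | ‖v y‖ < c} := by
        simp only [mem_setOf_eq, hx, norm_zero, hc]
      have hev : Gn =ᶠ[𝓝 x] fun _ => 0 :=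
        Filter.eventuallyEq_of_mem (hU.mem_nhds hxU) fun y hy => hG0 _ (le_of_lt hy)
      exact (contDiffAt_const (c := (0 : ℝ))).congr_of_eventuallyEq hev
    · exact hGC1.contDiffAt.comp x (hs_at x hx)
  -- the derivative of `Gn` along `v`
  have hDGn : ∀ x, fderiv ℝ Gn x (v x) = h ‖v x‖ * fderiv ℝ (fun y => ‖v y‖) x (v x) := by
    intro x
    by_cases hx : v x = 0
    · simp [hx]
    · have hd : DifferentiableAt ℝ (fun y => ‖v y‖) x := (hs_at x hx).differentiableAt one_ne_zero
      have hcomp := (hG ‖v x‖).comp_hasFDerivAt x hd.hasFDerivAt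
      rw [show Gn = G ∘ fun y => ‖v y‖ from rfl, hcomp.fderiv]
      simp [smul_eq_mul]
  -- the moderator `θ = Gn * q`
  set θ : EuclideanSpace ℝ (Fin 3) → ℝ := fun x => Gn x * q x with hθ
  have hθC1 : ContDiff ℝ 1 θ := hGnC1.mul hq
  obtain ⟨hK, -, hne⟩ := levelSetModeration_closure_superlevel hc hv hbdd
  have hθc : HasCompactSupport θ := by
    refine HasCompactSupport.intro hK fun x hx => ?_
    have hx' : ¬ c < ‖v x‖ := fun h' => hx (subset_closure h')
    show G ‖v x‖ * q x = 0
    rw [hG0 _ (not_lt.1 hx'), zero_mul]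
  have h0 := levelSetModeration_integral_fderiv_apply_eq_zero hv hdiv hθC1 hθc
  -- expand `Dθ(v) = Gn Dq(v) + q DGn(v)`
  have hexp : ∀ x, fderiv ℝ θ x (v x) =
      G ‖v x‖ * fderiv ℝ q x (v x) + q x * (h ‖v x‖ * fderiv ℝ (fun y => ‖v y‖) x (v x)) := by
    intro x
    have hd1 : DifferentiableAt ℝ Gn x := (hGnC1.differentiable one_ne_zero) x
    have hd2 : DifferentiableAt ℝ q x := (hq.differentiable one_ne_zero) x
    rw [show θ = fun y => Gn y * q y from rfl, fderiv_fun_mul hd1 hd2]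
    rw [add_apply, smul_apply, smul_apply, smul_eq_mul, smul_eq_mul, hDGn x]
  -- both summands are integrable (supported in `A`, continuous where `v ≠ 0`)
  have hS1eq : (fun x => G ‖v x‖ * fderiv ℝ q x (v x)) =
      A.indicator fun x => G ‖v x‖ * fderiv ℝ q x (v x) := by
    funext x
    by_cases hx : x ∈ A
    · rw [indicator_of_mem hx]
    · rw [indicator_of_notMem hx, hG0 _ (not_lt.1 hx), zero_mul]
  have hS2eq : (fun x => q x * (h ‖v x‖ * fderiv ℝ (fun y => ‖v y‖) x (v x))) =
      A.indicator fun x => q x * (h ‖v x‖ * fderiv ℝ (fun y => ‖v y‖) x (v x)) := by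
    funext x
    by_cases hx : x ∈ A
    · rw [indicator_of_mem hx]
    · rw [indicator_of_notMem hx, hh0 _ (not_lt.1 hx), zero_mul, mul_zero]
  have hI1 : Integrable (fun x => G ‖v x‖ * fderiv ℝ q x (v x)) volume := by
    rw [hS1eq]
    exact levelSetModeration_integrable_indicator_superlevel hc hv hbdd fun x _ =>
      ((hGc.comp hvc.norm).mul (hDq.clm_apply hvc)).continuousAt
  have hI2 : Integrable (fun x => q x * (h ‖v x‖ * fderiv ℝ (fun y => ‖v y‖) x (v x))) volume := by
    rw [hS2eq]
    exact levelSetModeration_integrable_indicator_superlevel hc hv hbdd fun x hx =>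
      hqc.continuousAt.mul (((hh.comp hvc.norm).continuousAt).mul
        ((levelSetModeration_continuousAt_fderiv_norm hv hx).clm_apply hvc.continuousAt))
  have hsum : (∫ x, G ‖v x‖ * fderiv ℝ q x (v x)) +
      ∫ x, q x * (h ‖v x‖ * fderiv ℝ (fun y => ‖v y‖) x (v x)) = 0 := by
    rw [← integral_add hI1 hI2]
    simpa only [hexp] using h0
  linarith

/-- **The level-set integration by parts** (registered stub `stub_levelSetIBP` of the crux item
stmt-NavierStokesRegularity-18149, line `Sketch`; Vasseur 2007, proof of Lemma 11, pressure term):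
for `v ∈ C¹(ℝ³; ℝ³)` divergence free with bounded `{c < |v|}` (`c > 0`) and `q ∈ C¹(ℝ³)`,
`-∫ (1 - c/|v x|)₊ Dq(x)(v x) dx = ∫ 1_{c<|v|} (c/|v x|²) (D|v|(x)(v x)) q(x) dx`.
(At a zero of `v` Lean's `c/0 = 0` makes the printed weight `1`, harmlessly: `Dq(x)(0) = 0`.)
[cite: Vasseur2007, Lemma 11] -/
theorem stub_levelSetIBP :
    ∀ (v : EuclideanSpace ℝ (Fin 3) → EuclideanSpace ℝ (Fin 3)) (q : EuclideanSpace ℝ (Fin 3) → ℝ) (c : ℝ), 0 < c → ContDiff ℝ 1 v → ContDiff ℝ 1 q → Literature.Analysis.FluidPDE.VectorCalculus.IsDivFree v → Bornology.IsBounded {x | c < ‖v x‖} → -(∫ x, max (1 - c / ‖v x‖) 0 * (fderiv ℝ q x (v x))) = ∫ x, Set.indicator {x | c < ‖v x‖} (fun x => c / ‖v x‖ ^ 2 * (fderiv ℝ (fun y => ‖v y‖) x (v x)) * q x) x := by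
  intro v q c hc hv hq hdiv hbdd
  set A : Set (EuclideanSpace ℝ (Fin 3)) := {x | c < ‖v x‖} with hA
  have hvc : Continuous v := hv.continuous
  have hqc : Continuous q := hq.continuous
  have hDq : Continuous (fderiv ℝ q) := hq.continuous_fderiv one_ne_zero
  obtain ⟨hK, hKsub, hne⟩ := levelSetModeration_closure_superlevel hc hv hbdd
  -- Step 0: the printed weight is the continuous weight `w(|v|)`, `w(σ) = (σ-c)₊/max(σ,c)`
  set w : ℝ → ℝ := fun σ => max (σ - c) 0 / max σ c with hw
  have hw_le : ∀ σ, σ ≤ c → w σ = 0 := fun σ hσ => by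
    show max (σ - c) 0 / max σ c = 0
    rw [max_eq_right (by linarith), zero_div]
  have hw_ge : ∀ σ, c ≤ σ → w σ = 1 - c / σ := fun σ hσ => by
    have hσ0 : 0 < σ := hc.trans_le hσ
    show max (σ - c) 0 / max σ c = 1 - c / σ
    rw [max_eq_left (by linarith), max_eq_left hσ]
    field_simp
  have hLHS : (fun x => max (1 - c / ‖v x‖) 0 * fderiv ℝ q x (v x)) =
      fun x => w ‖v x‖ * fderiv ℝ q x (v x) := by
    funext x
    exact (LevelSetEnergyInequality.weight_mul_eq_posPart_mul hc (v x)
      (a := fderiv ℝ q x (v x)) (fun h0 => by rw [h0, map_zero])).symm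
  rw [hLHS]
  -- Step 1: the cut-offs `ρₙ`, the derivatives `hₙ` and the profiles `Gₙ`
  set ρ : ℕ → ℝ → ℝ := fun n σ => min 1 (max 0 (n * (σ - c))) with hρ
  have hρ_cont : ∀ n, Continuous (ρ n) := fun n =>
    continuous_const.min (continuous_const.max (continuous_const.mul
      (continuous_id.sub continuous_const)))
  have hρ_nonneg : ∀ n σ, 0 ≤ ρ n σ := fun n σ => le_min zero_le_one (le_max_left _ _)
  have hρ_le_one : ∀ n σ, ρ n σ ≤ 1 := fun n σ => min_le_left _ _
  have hρ_zero : ∀ n σ, σ ≤ c → ρ n σ = 0 := by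
    intro n σ hσ
    have hnp : (n : ℝ) * (σ - c) ≤ 0 := mul_nonpos_of_nonneg_of_nonpos n.cast_nonneg (sub_nonpos.2 hσ)
    show min 1 (max 0 ((n : ℝ) * (σ - c))) = 0
    rw [max_eq_left hnp, min_eq_right zero_le_one]
  have hρ_lim : ∀ σ, c < σ → Tendsto (fun n => ρ n σ) atTop (𝓝 1) := by
    intro σ hσ
    obtain ⟨N, hN⟩ := exists_nat_gt (σ - c)⁻¹
    refine tendsto_const_nhds.congr' (eventually_atTop.2 ⟨N, fun n hn => ?_⟩)
    have hσc : 0 < σ - c := sub_pos.2 hσ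
    have h1 : 1 ≤ (n : ℝ) * (σ - c) := by
      have hNn : (σ - c)⁻¹ ≤ n := hN.le.trans (Nat.cast_le.2 hn)
      calc (1 : ℝ) = (σ - c)⁻¹ * (σ - c) := by field_simp
        _ ≤ n * (σ - c) := mul_le_mul_of_nonneg_right hNn hσc.le
    show (1 : ℝ) = min 1 (max 0 ((n : ℝ) * (σ - c)))
    rw [min_eq_left (le_max_of_le_right h1)]
  set hm : ℕ → ℝ → ℝ := fun n τ => ρ n τ * (c / (max τ (c / 2)) ^ 2) with hhm
  have hmax_pos : ∀ τ : ℝ, 0 < max τ (c / 2) := fun τ => lt_of_lt_of_le (half_pos hc) (le_max_right _ _)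
  have hker_cont : Continuous fun τ : ℝ => c / (max τ (c / 2)) ^ 2 :=
    continuous_const.div ((continuous_id.max continuous_const).pow 2) fun τ =>
      pow_ne_zero 2 (hmax_pos τ).ne'
  have hm_cont : ∀ n, Continuous (hm n) := fun n => (hρ_cont n).mul hker_cont
  have hm_zero : ∀ n τ, τ ≤ c → hm n τ = 0 := fun n τ hτ => by
    show ρ n τ * (c / (max τ (c / 2)) ^ 2) = 0
    rw [hρ_zero n τ hτ, zero_mul]
  -- the kernel bound `0 ≤ c / max(τ,c/2)² ≤ 4/c`
  have hker_nonneg : ∀ τ : ℝ, 0 ≤ c / (max τ (c / 2)) ^ 2 := fun τ => by positivity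
  have hker_le : ∀ τ : ℝ, c / (max τ (c / 2)) ^ 2 ≤ 4 / c := fun τ => by
    rw [div_le_div_iff₀ (pow_pos (hmax_pos τ) 2) hc]
    have h2 : c / 2 ≤ max τ (c / 2) := le_max_right _ _
    nlinarith [h2, hc]
  have hm_abs : ∀ n τ, |hm n τ| ≤ 4 / c := fun n τ => by
    show |ρ n τ * (c / (max τ (c / 2)) ^ 2)| ≤ 4 / c
    rw [abs_mul, abs_of_nonneg (hρ_nonneg n τ), abs_of_nonneg (hker_nonneg τ)]
    calc ρ n τ * (c / (max τ (c / 2)) ^ 2) ≤ 1 * (4 / c) :=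
          mul_le_mul (hρ_le_one n τ) (hker_le τ) (hker_nonneg τ) zero_le_one
      _ = 4 / c := one_mul _
  set Gp : ℕ → ℝ → ℝ := fun n σ => ∫ τ in c..σ, hm n τ with hGp
  have hGp_deriv : ∀ n σ, HasDerivAt (Gp n) (hm n σ) σ := fun n σ =>
    ((hm_cont n).integral_hasStrictDerivAt c σ).hasDerivAt
  have hGp_zero : ∀ n σ, σ ≤ c → Gp n σ = 0 := by
    intro n σ hσ
    show (∫ τ in c..σ, hm n τ) = 0
    rw [integral_congr (g := fun _ => (0 : ℝ)) ?_, intervalIntegral.integral_zero]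
    intro τ hτ
    rw [uIcc_of_ge hσ] at hτ
    exact hm_zero n τ hτ.2
  -- `|Gₙ(σ)| ≤ (4/c) |σ - c|`
  have hGp_abs : ∀ n σ, |Gp n σ| ≤ 4 / c * |σ - c| := by
    intro n σ
    have := intervalIntegral.norm_integral_le_of_norm_le_const (a := c) (b := σ)
      (f := hm n) (C := 4 / c) fun τ _ => by rw [Real.norm_eq_abs]; exact hm_abs n τ
    rw [Real.norm_eq_abs] at this
    exact this
  -- `Gₙ(σ) → w(σ)` for every `σ`
  have hGp_lim : ∀ σ, Tendsto (fun n => Gp n σ) atTop (𝓝 (w σ)) := by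
    intro σ
    rcases le_or_gt σ c with hσ | hσ
    · simp only [hGp_zero _ σ hσ, hw_le σ hσ]
      exact tendsto_const_nhds
    · -- dominated convergence on `[c, σ]`, limit `1_{τ>c} c/τ²` and FTC
      have hσ0 : 0 < σ := hc.trans hσ
      set f : ℝ → ℝ := fun τ => if c < τ then c / (max τ (c / 2)) ^ 2 else 0 with hf
      have hlimf : (∫ τ in c..σ, f τ) = w σ := by
        -- `f = c/τ²` a.e. on `[c, σ]`, and `∫_c^σ c/τ² = 1 - c/σ`
        have h1 : (∫ τ in c..σ, f τ) = ∫ τ in c..σ, c / τ ^ 2 := by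
          refine integral_congr_ae (Eventually.of_forall fun τ hτ => ?_)
          rw [uIoc_of_le hσ.le] at hτ
          have hτc' : c < τ := hτ.1
          rw [hf]
          simp only [if_pos hτc']
          rw [max_eq_left (by linarith)]
        have h2 : (∫ τ in c..σ, c / τ ^ 2) = 1 - c / σ := by
          have hderiv : ∀ τ ∈ uIcc c σ, HasDerivAt (fun τ : ℝ => 1 - c / τ) (c / τ ^ 2) τ := by
            intro τ hτ
            rw [uIcc_of_le hσ.le] at hτ
            have hτ0 : τ ≠ 0 := (hc.trans_le hτ.1).ne'
            have h := ((hasDerivAt_inv hτ0).const_mul c).const_sub 1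
            have hfun : (fun τ : ℝ => 1 - c / τ) = fun y => 1 - c * y⁻¹ := by
              funext y; rw [div_eq_mul_inv]
            rw [hfun]
            refine h.congr_deriv ?_
            rw [div_eq_mul_inv]
            ring
          have hint : IntervalIntegrable (fun τ : ℝ => c / τ ^ 2) volume c σ := by
            refine (ContinuousOn.intervalIntegrable ?_)
            refine continuousOn_const.div (continuousOn_id.pow 2) fun τ hτ => ?_
            rw [uIcc_of_le hσ.le] at hτ
            exact pow_ne_zero 2 (hc.trans_le hτ.1).ne'
          rw [integral_eq_sub_of_hasDerivAt hderiv hint, div_self hc.ne']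
          ring
        rw [h1, h2, hw_ge σ hσ.le]
      rw [← hlimf]
      refine intervalIntegral.tendsto_integral_filter_of_dominated_convergence (fun _ => 4 / c)
        (Eventually.of_forall fun n => ((hm_cont n).aestronglyMeasurable).restrict) ?_ ?_ ?_
      · exact Eventually.of_forall fun n => Eventually.of_forall fun τ _ => by
          rw [Real.norm_eq_abs]; exact hm_abs n τ
      · exact intervalIntegrable_const
      · refine Eventually.of_forall fun τ _ => ?_
        by_cases hτ : c < τ
        · rw [hf]; simp only [if_pos hτ]
          have := (hρ_lim τ hτ).mul_const (c / (max τ (c / 2)) ^ 2)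
          rw [one_mul] at this
          exact this
        · rw [hf]; simp only [if_neg hτ]
          have : (fun n => hm n τ) = fun _ => 0 := funext fun n => hm_zero n τ (not_lt.1 hτ)
          rw [this]; exact tendsto_const_nhds
  -- Step 2: the regularised identities
  have hreg : ∀ n, ∫ x, Gp n ‖v x‖ * fderiv ℝ q x (v x) =
      -∫ x, q x * (hm n ‖v x‖ * fderiv ℝ (fun y => ‖v y‖) x (v x)) := fun n =>
    levelSetModeration_integral_comp_norm_mul_fderiv_apply hc hv hdiv hbdd hq (hGp_deriv n)
      (hm_cont n) (hGp_zero n) (hm_zero n)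
  -- Step 3: dominated convergence on the `G`-side
  have hGpc : ∀ n, Continuous (Gp n) := fun n =>
    continuous_iff_continuousAt.2 fun σ => (hGp_deriv n σ).continuousAt
  have hwv : ∀ x, x ∉ A → w ‖v x‖ = 0 := fun x hx => hw_le _ (not_lt.1 hx)
  have hlimG : Tendsto (fun n => ∫ x, Gp n ‖v x‖ * fderiv ℝ q x (v x)) atTop
      (𝓝 (∫ x, w ‖v x‖ * fderiv ℝ q x (v x))) := by
    refine tendsto_integral_of_dominated_convergence
      (fun x => A.indicator (fun x => 4 / c * |‖v x‖ - c| * |fderiv ℝ q x (v x)|) x)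
      (fun n => (((hGpc n).comp hvc.norm).mul (hDq.clm_apply hvc)).aestronglyMeasurable) ?_ ?_ ?_
    · exact levelSetModeration_integrable_indicator_superlevel hc hv hbdd fun x _ =>
        ((continuous_const.mul (hvc.norm.sub continuous_const).abs).mul
          (hDq.clm_apply hvc).abs).continuousAt
    · intro n
      refine Eventually.of_forall fun x => ?_
      by_cases hx : x ∈ A
      · rw [indicator_of_mem hx, Real.norm_eq_abs, abs_mul]
        exact mul_le_mul_of_nonneg_right (hGp_abs n _) (abs_nonneg _)
      · rw [indicator_of_notMem hx, hGp_zero n _ (not_lt.1 hx), zero_mul, norm_zero]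
    · exact Eventually.of_forall fun x => (hGp_lim ‖v x‖).mul_const _
  -- Step 4: dominated convergence on the `h`-side
  set T : EuclideanSpace ℝ (Fin 3) → ℝ :=
    A.indicator fun x => c / ‖v x‖ ^ 2 * (fderiv ℝ (fun y => ‖v y‖) x (v x)) * q x with hT
  have hH_eq : ∀ n, (fun x => q x * (hm n ‖v x‖ * fderiv ℝ (fun y => ‖v y‖) x (v x))) =
      A.indicator fun x => q x * (hm n ‖v x‖ * fderiv ℝ (fun y => ‖v y‖) x (v x)) := by
    intro n; funext x
    by_cases hx : x ∈ A
    · rw [indicator_of_mem hx]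
    · rw [indicator_of_notMem hx, hm_zero n _ (not_lt.1 hx), zero_mul, mul_zero]
  have hH_int : ∀ n, Integrable
      (fun x => q x * (hm n ‖v x‖ * fderiv ℝ (fun y => ‖v y‖) x (v x))) volume := by
    intro n
    rw [hH_eq n]
    exact levelSetModeration_integrable_indicator_superlevel hc hv hbdd fun x hx =>
      hqc.continuousAt.mul ((((hm_cont n).comp hvc.norm).continuousAt).mul
        ((levelSetModeration_continuousAt_fderiv_norm hv hx).clm_apply hvc.continuousAt))
  have hT_int : Integrable (A.indicator fun x =>
      |q x| * (c / ‖v x‖ ^ 2 * |fderiv ℝ (fun y => ‖v y‖) x (v x)|)) volume := by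
    refine levelSetModeration_integrable_indicator_superlevel hc hv hbdd fun x hx => ?_
    have h2 : ContinuousAt (fun y => c / ‖v y‖ ^ 2) x :=
      continuousAt_const.div (hvc.norm.pow 2).continuousAt (pow_ne_zero 2 (norm_ne_zero_iff.2 hx))
    exact hqc.continuousAt.abs.mul (h2.mul
      ((levelSetModeration_continuousAt_fderiv_norm hv hx).clm_apply hvc.continuousAt).abs)
  have hlimH : Tendsto (fun n => ∫ x, q x * (hm n ‖v x‖ * fderiv ℝ (fun y => ‖v y‖) x (v x)))
      atTop (𝓝 (∫ x, T x)) := by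
    refine tendsto_integral_of_dominated_convergence
      (fun x => A.indicator (fun x => |q x| * (c / ‖v x‖ ^ 2 * |fderiv ℝ (fun y => ‖v y‖) x (v x)|)) x)
      (fun n => (hH_int n).aestronglyMeasurable) hT_int ?_ ?_
    · intro n
      refine Eventually.of_forall fun x => ?_
      by_cases hx : x ∈ A
      · have hx' : c < ‖v x‖ := hx
        have hmax : max ‖v x‖ (c / 2) = ‖v x‖ := max_eq_left (by linarith)
        rw [indicator_of_mem hx, Real.norm_eq_abs, abs_mul, abs_mul]
        refine mul_le_mul_of_nonneg_left ?_ (abs_nonneg _)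
        refine mul_le_mul_of_nonneg_right ?_ (abs_nonneg _)
        show |ρ n ‖v x‖ * (c / (max ‖v x‖ (c / 2)) ^ 2)| ≤ c / ‖v x‖ ^ 2
        rw [hmax, abs_mul, abs_of_nonneg (hρ_nonneg n _),
          abs_of_nonneg (by positivity : (0 : ℝ) ≤ c / ‖v x‖ ^ 2)]
        calc ρ n ‖v x‖ * (c / ‖v x‖ ^ 2) ≤ 1 * (c / ‖v x‖ ^ 2) :=
              mul_le_mul_of_nonneg_right (hρ_le_one n _) (by positivity)
          _ = c / ‖v x‖ ^ 2 := one_mul _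
      · rw [indicator_of_notMem hx, hm_zero n _ (not_lt.1 hx), zero_mul, mul_zero, norm_zero]
    · refine Eventually.of_forall fun x => ?_
      by_cases hx : x ∈ A
      · have hx' : c < ‖v x‖ := hx
        have hmax : max ‖v x‖ (c / 2) = ‖v x‖ := max_eq_left (by linarith)
        rw [hT, indicator_of_mem hx]
        have h1 : Tendsto (fun n => hm n ‖v x‖) atTop (𝓝 (c / ‖v x‖ ^ 2)) := by
          have h0 : ∀ n, hm n ‖v x‖ = ρ n ‖v x‖ * (c / ‖v x‖ ^ 2) := fun n => by
            show ρ n ‖v x‖ * (c / (max ‖v x‖ (c / 2)) ^ 2) = _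
            rw [hmax]
          simp_rw [h0]
          have := (hρ_lim ‖v x‖ hx').mul_const (c / ‖v x‖ ^ 2)
          rwa [one_mul] at this
        have h2 := (h1.mul_const (fderiv ℝ (fun y => ‖v y‖) x (v x))).const_mul (q x)
        refine h2.congr' (Eventually.of_forall fun n => rfl) |>.trans ?_
        rw [show q x * (c / ‖v x‖ ^ 2 * fderiv ℝ (fun y => ‖v y‖) x (v x)) =
          c / ‖v x‖ ^ 2 * fderiv ℝ (fun y => ‖v y‖) x (v x) * q x by ring]
      · rw [hT, indicator_of_notMem hx]
        have : (fun n => q x * (hm n ‖v x‖ * fderiv ℝ (fun y => ‖v y‖) x (v x))) = fun _ => 0 :=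
          funext fun n => by rw [hm_zero n _ (not_lt.1 hx), zero_mul, mul_zero]
        rw [this]
        exact tendsto_const_nhds
  -- Step 5: pass to the limit in the regularised identities
  have hlimG' : Tendsto (fun n => ∫ x, Gp n ‖v x‖ * fderiv ℝ q x (v x)) atTop
      (𝓝 (-∫ x, T x)) := by
    have := hlimH.neg
    refine this.congr fun n => ?_
    rw [hreg n]
  have hEq := tendsto_nhds_unique hlimG hlimG'
  rw [hEq, neg_neg]

end IBP

end Summit.NavierStokesRegularity.NavierStokesRegularity.Theorems
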